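import Literature.AlgebraicGeometry.Resolution.SharpMonoidEmbedding
import Literature.Analysis.Convex.FarkasMinkowskiWeyl
import HarnessLib

/-!
# Reflecting sharp embeddings: `P/F ↪ ℕ^M` as a PURE submonoid (all facets of the dual cone)

`Literature/AlgebraicGeometry/Resolution/ReflectingSharpEmbedding.lean`. For the chart monoid
`P ⊆ ℤⁿ` (finitely generated, saturated) of a log regular local ring and the face `F` of units,
K. Kato, *Toric singularities*, Amer. J. Math. 116 (1994), Thm. (3.2), places the sharp fs monoid
`P̄ = P/F` inside a free monoid `ℕ^r`; the tree's `LogChart.exists_isSharpEmbedding`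
(`SharpMonoidEmbedding.lean`) uses `n` linearly independent integral vectors of the dual cone. Such
an embedding need not be PURE (`e(P) = gp(e P) ∩ ℕ^M`; e.g. `(a,b) ↦ (a, a+b)` on `ℕ²` is not), and
purity is what makes `Λ⟦P̄⟧` a direct summand of `Λ⟦x₁..x_M⟧` (W. Bruns, J. Gubeladze, *Polytopes,
Rings, and K-Theory* (2009), Thm. 2.29 / Thm. 4.38: a normal affine monoid embeds as a pure
submonoid of `ℤ^M₊`, by taking ALL support forms). We PROVE the existence of a REFLECTING sharp
embedding — coordinates = a finite generating system of the integral dual cone of `π(P)`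
(Minkowski–Weyl, tree `FarkasMinkowskiWeyl.exists_generators_of_cone_le`, plus the tree's Farkas
for monoids `exists_nsmul_mem_of_forall_dotProduct_nonneg`):

* `dotProduct_nonneg_of_mem_closure` — dual vectors pair non-negatively with the monoid;
* `exists_dualInt_generators` — finitely many integral dual vectors `ℓᵢ` of `⟨v⟩` such that
  `ℓᵢ·x ≥ 0 ∀ i` implies `u·x ≥ 0` for every integral dual vector `u`;
* `mem_closure_of_forall_generators_nonneg` — for `⟨v⟩` saturated in `ℤⁿ`, `ℓᵢ·x ≥ 0 ∀ i ⇒ x ∈ ⟨v⟩`;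
* `IsFaceOf.nsmul_mem_map_proj` — `π(P)` is saturated in `ℤⁿ` (for `P` saturated);
* `exists_isSharpEmbedding_reflecting` — **∃ `e : ℤⁿ →+ ℤ^M` with `IsSharpEmbedding P F e` which
  REFLECTS `P`: `e x ≥ 0 ⇒ e x = e q` for some `q ∈ P`**;
* `embMonoid_pure` — for a reflecting sharp embedding the embedded monoid `P′ = e(P) ⊆ ℕ^M` is pure:
  `a ∈ P′`, `a + b ∈ P′` ⇒ `b ∈ P′`.

References: [Kato1994] K. Kato, Toric singularities, Amer. J. Math. 116 (1994), (3.2), (9.8);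
[BrunsGubeladze2009] W. Bruns, J. Gubeladze, Polytopes, Rings, and K-Theory (2009), Thm. 2.29,
Thm. 4.38; [Fulton1993Toric] W. Fulton, Introduction to Toric Varieties, §1.2 (Gordan, Farkas);
[Schrijver1986] A. Schrijver, Theory of linear and integer programming, Cor. 7.1a.
-/

noncomputable section

open Matrix

namespace Literature.AlgebraicGeometry.Resolution

namespace LogChart

universe u

variable {n : ℕ}

/-! ### Casts and denominators -/

/-- The coordinatewise cast `ℤⁿ → ℚⁿ` (`Int.cast ∘ ·`) commutes with dot products. [folklore] -/
private theorem icast_dotProduct (u v : Fin n → ℤ) :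
    (Int.cast ∘ u : Fin n → ℚ) ⬝ᵥ (Int.cast ∘ v : Fin n → ℚ) = ((u ⬝ᵥ v : ℤ) : ℚ) := by
  simp only [dotProduct, Function.comp]; push_cast; rfl

/-- A rational vector is `N⁻¹` times an integral one. [folklore] -/
private theorem exists_int_mul' (y : Fin n → ℚ) :
    ∃ N : ℕ, 0 < N ∧ ∃ u : Fin n → ℤ, ∀ i, (u i : ℚ) = N * y i := by
  refine ⟨∏ i, (y i).den, Finset.prod_pos fun i _ => (y i).den_pos, ?_⟩
  have h : ∀ i, ∃ z : ℤ, (z : ℚ) = (∏ j, (y j).den : ℕ) * y i := by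
    intro i
    obtain ⟨c, hc⟩ : (y i).den ∣ ∏ j, (y j).den := Finset.dvd_prod_of_mem _ (Finset.mem_univ i)
    refine ⟨(y i).num * c, ?_⟩
    rw [hc]
    push_cast
    have := Rat.mul_den_eq_num (y i)
    calc ((y i).num : ℚ) * c = (y i * (y i).den) * c := by rw [this]
      _ = ((y i).den * c : ℚ) * y i := by ring
  choose u hu using h
  exact ⟨u, hu⟩

/-! ### Integral generators of the dual cone -/

variable {k : ℕ} (v : Fin k → (Fin n → ℤ))

/-- Integral dual vectors pair non-negatively with every element of the monoid `⟨v₁,…,v_k⟩`.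
[cite: Fulton1993Toric, §1.2] -/
theorem dotProduct_nonneg_of_mem_closure {u : Fin n → ℤ} (hu : u ∈ dualInt v) {s : Fin n → ℤ}
    (hs : s ∈ AddSubmonoid.closure (Set.range v)) : 0 ≤ u ⬝ᵥ s := by
  induction hs using AddSubmonoid.closure_induction with
  | mem x hx =>
    obtain ⟨j, rfl⟩ := hx
    exact hu j
  | zero => rw [dotProduct_zero]
  | add x y _ _ hx hy => rw [dotProduct_add]; exact add_nonneg hx hy

/-- **Integral generators of the dual cone** (Minkowski–Weyl / Gordan): there are finitely many
integral vectors `ℓ₁,…,ℓ_M` of the dual cone of `⟨v₁,…,v_k⟩` such that every integral `x` with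
`ℓᵢ·x ≥ 0` for all `i` pairs non-negatively with EVERY integral dual vector (the `ℓᵢ` generate
the rational dual cone). [cite: Schrijver1986, Cor 7.1a (p. 87-88)] [cite: Fulton1993Toric, §1.2] -/
theorem exists_dualInt_generators :
    ∃ (M : ℕ) (ℓ : Fin M → (Fin n → ℤ)), (∀ i, ℓ i ∈ dualInt v) ∧
      ∀ x : Fin n → ℤ, (∀ i, 0 ≤ ℓ i ⬝ᵥ x) → ∀ u ∈ dualInt v, 0 ≤ u ⬝ᵥ x := by
  classical
  obtain ⟨M, g, hg⟩ := Literature.Analysis.Convex.FarkasMinkowskiWeyl.exists_generators_of_cone_le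
    (𝕜 := ℚ) (κ := Fin n) k (fun j => -(Int.cast ∘ v j : Fin n → ℚ))
  -- each generator `g i` lies in the rational dual cone
  have hgi : ∀ i j, 0 ≤ g i ⬝ᵥ (Int.cast ∘ v j : Fin n → ℚ) := by
    intro i j
    have hmem : ∃ l : Fin M → ℚ, (∀ i', 0 ≤ l i') ∧ ∑ i', l i' • g i' = g i :=
      ⟨Pi.single i 1, fun i' => by
        rcases eq_or_ne i' i with rfl | h
        · rw [Pi.single_eq_same]; exact zero_le_one
        · rw [Pi.single_eq_of_ne h],
       by rw [Finset.sum_eq_single i (fun b _ hb => by rw [Pi.single_eq_of_ne hb, zero_smul])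
            (fun h => (h (Finset.mem_univ i)).elim), Pi.single_eq_same, one_smul]⟩
    have h := ((hg (g i)).2 hmem) j
    rw [neg_dotProduct, neg_nonpos, dotProduct_comm] at h
    exact h
  -- clear denominators
  have hden : ∀ i, ∃ N : ℕ, 0 < N ∧ ∃ w : Fin n → ℤ, ∀ i', (w i' : ℚ) = N * g i i' :=
    fun i => exists_int_mul' (g i)
  choose N hN ℓ hℓ using hden
  have hqℓ : ∀ i, (Int.cast ∘ ℓ i : Fin n → ℚ) = (N i : ℚ) • g i := fun i => by
    funext i'; rw [Function.comp_apply, Pi.smul_apply, smul_eq_mul]; exact hℓ i i'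
  refine ⟨M, ℓ, fun i j => ?_, fun x hx u hu => ?_⟩
  · have h1 : (0 : ℚ) ≤ ((ℓ i ⬝ᵥ v j : ℤ) : ℚ) := by
      rw [← icast_dotProduct, hqℓ, smul_dotProduct, smul_eq_mul]
      exact mul_nonneg (by positivity) (hgi i j)
    exact_mod_cast h1
  · -- `u` is a non-negative rational combination of the `g i`
    have hu' : ∀ j, (-(Int.cast ∘ v j : Fin n → ℚ)) ⬝ᵥ (Int.cast ∘ u : Fin n → ℚ) ≤ 0 := by
      intro j
      rw [neg_dotProduct, neg_nonpos, dotProduct_comm, icast_dotProduct]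
      exact_mod_cast hu j
    obtain ⟨l, hl, hlu⟩ := (hg ((Int.cast ∘ u : Fin n → ℚ))).1 hu'
    have hgx : ∀ i, 0 ≤ g i ⬝ᵥ (Int.cast ∘ x : Fin n → ℚ) := by
      intro i
      have h1 : (N i : ℚ) * (g i ⬝ᵥ (Int.cast ∘ x : Fin n → ℚ)) = ((ℓ i ⬝ᵥ x : ℤ) : ℚ) := by
        rw [← icast_dotProduct, hqℓ, smul_dotProduct, smul_eq_mul]
      have h2 : (0 : ℚ) ≤ (N i : ℚ) * (g i ⬝ᵥ (Int.cast ∘ x : Fin n → ℚ)) := by rw [h1]; exact_mod_cast hx i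
      exact nonneg_of_mul_nonneg_right (by rwa [mul_comm] at h2) (by exact_mod_cast hN i)
    have h3 : (0 : ℚ) ≤ ((u ⬝ᵥ x : ℤ) : ℚ) := by
      rw [← icast_dotProduct, ← hlu, sum_dotProduct]
      exact Finset.sum_nonneg fun i _ => by
        rw [smul_dotProduct, smul_eq_mul]; exact mul_nonneg (hl i) (hgx i)
    exact_mod_cast h3

/-- **Reflection for saturated monoids.** If `S = ⟨v₁,…,v_k⟩` is saturated in `ℤⁿ`
(`N x ∈ S`, `N > 0` ⇒ `x ∈ S`) and `ℓ₁,…,ℓ_M` are integral dual generators as in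
`exists_dualInt_generators`, then `ℓᵢ·x ≥ 0 ∀ i` implies `x ∈ S` (Farkas for monoids).
[cite: Fulton1993Toric, §1.2] -/
theorem mem_closure_of_forall_generators_nonneg
    (hsat : ∀ (x : Fin n → ℤ) (N : ℕ), 0 < N → N • x ∈ AddSubmonoid.closure (Set.range v) →
      x ∈ AddSubmonoid.closure (Set.range v))
    {M : ℕ} {ℓ : Fin M → (Fin n → ℤ)}
    (hℓ : ∀ x : Fin n → ℤ, (∀ i, 0 ≤ ℓ i ⬝ᵥ x) → ∀ u ∈ dualInt v, 0 ≤ u ⬝ᵥ x)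
    {x : Fin n → ℤ} (hx : ∀ i, 0 ≤ ℓ i ⬝ᵥ x) : x ∈ AddSubmonoid.closure (Set.range v) := by
  obtain ⟨N, hN, hNx⟩ := exists_nsmul_mem_of_forall_dotProduct_nonneg v (hℓ x hx)
  exact hsat x N hN hNx

/-! ### The projected monoid `π(P)` is saturated -/

namespace IsFaceOf

variable {P F : AddSubmonoid (Fin n → ℤ)}

/-- For `P` saturated in `ℤⁿ` and the splitting `π` of the face `F` (`π = 0` on `F^{gp}`,
`v - π v ∈ F^{gp}`, `π ∘ π = π`), the sharp monoid `π(P)` is saturated in `ℤⁿ`: if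
`N x = π p` then `N x + b = p + a` with `a, b ∈ F`, so `N (x + b) ∈ P`, `x + b ∈ P`, and
`x = π x = π (x + b)`. [cite: Kato1994, (3.2)] -/
theorem nsmul_mem_map_proj (hsat : ∀ (v : Fin n → ℤ) (k : ℕ), 0 < k → k • v ∈ P → v ∈ P)
    {π : (Fin n → ℤ) →ₗ[ℤ] (Fin n → ℤ)}
    (hπ0 : ∀ v ∈ Submodule.span ℤ (F : Set (Fin n → ℤ)), π v = 0)
    (hπ1 : ∀ v, v - π v ∈ Submodule.span ℤ (F : Set (Fin n → ℤ)))
    (hπ2 : ∀ v, π (π v) = π v) (hFP : F ≤ P)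
    {x : Fin n → ℤ} {N : ℕ} (hN : 0 < N) (hx : N • x ∈ P.map π.toAddMonoidHom) :
    x ∈ P.map π.toAddMonoidHom := by
  obtain ⟨p, hp, hpx⟩ := AddSubmonoid.mem_map.1 hx
  have hpx' : π p = N • x := hpx
  -- `x = π x`
  have hxπ : π x = x := by
    have h1 : N • π x = N • x := by rw [← map_nsmul, ← hpx', hπ2]
    funext i
    have h2 := congrFun h1 i
    simp only [Pi.smul_apply, nsmul_eq_mul] at h2
    exact Int.eq_of_mul_eq_mul_left (by exact_mod_cast hN.ne') h2
  -- `π p = p + a - b` with `a b ∈ F`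
  obtain ⟨a, ha, b, hb, hab⟩ := (mem_span_int_iff_exists_sub F).1 (hπ1 p)
  -- so `N • (x + b) = p - ... ` : `N x + b = p - a + b`? Precisely `N • x = π p = p - (a - b)`.
  have hNx : N • x + a = p + b := by
    rw [← hpx']
    have : π p = p - (a - b) := by rw [← hab]; abel
    rw [this]; abel
  have hmem : N • (x + a) ∈ P := by
    have h1 : N • (x + a) = (N • x + a) + (N - 1) • a := by
      obtain ⟨m, rfl⟩ := Nat.exists_eq_succ_of_ne_zero hN.ne'
      rw [Nat.succ_sub_one, succ_nsmul, smul_add, succ_nsmul]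
      abel
    rw [h1, hNx]
    exact P.add_mem (P.add_mem hp (hFP hb)) (P.nsmul_mem (hFP ha) _)
  have hxa : x + a ∈ P := hsat _ N hN hmem
  refine AddSubmonoid.mem_map.2 ⟨x + a, hxa, ?_⟩
  show π (x + a) = x
  rw [map_add, hπ0 a (Submodule.subset_span ha), add_zero, hxπ]

end IsFaceOf

/-! ### Reflecting sharp embeddings exist -/

/-- **Existence of a REFLECTING sharp embedding.** For a chart monoid `P ⊆ ℤⁿ` (finitely generated,
saturated) and a face `F` there are `M` and an additive `e : ℤⁿ → ℤ^M` with
`LogChart.IsSharpEmbedding P F e` (kills `F`, non-negative on `P`, injective on `P` mod `F^{gp}`)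
which moreover REFLECTS `P`: every `x ∈ ℤⁿ` with `e x ≥ 0` has `e x = e q` for some `q ∈ P`. The
coordinates of `e` are integral generators of the dual cone of the sharp quotient `π(P)` (all
support forms, Bruns–Gubeladze Thm. 2.29), composed with the splitting `π` of `F`.
[cite: BrunsGubeladze2009, Thm. 2.29 and Thm. 4.38] [cite: Kato1994, (3.2)] -/
theorem exists_isSharpEmbedding_reflecting {P F : AddSubmonoid (Fin n → ℤ)} (hP : P.FG)
    (h : IsFaceOf F P) (hsat : ∀ (v : Fin n → ℤ) (k : ℕ), 0 < k → k • v ∈ P → v ∈ P) :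
    ∃ (M : ℕ) (e : (Fin n → ℤ) →+ (Fin M → ℤ)), IsSharpEmbedding P F e ∧
      ∀ x : Fin n → ℤ, (∀ i, 0 ≤ e x i) → ∃ q ∈ P, e q = e x := by
  classical
  obtain ⟨π, hπ0, hπ1, hπ2⟩ := h.exists_proj hsat
  -- generators of the sharp monoid `π(P)`
  obtain ⟨T, hT⟩ := IsFaceOf.map_proj_fg (P := P) (π := π) hP
  let v : Fin T.card → (Fin n → ℤ) := fun i => (T.equivFin.symm i : Fin n → ℤ)
  have hS : AddSubmonoid.closure (Set.range v) = P.map π.toAddMonoidHom := by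
    rw [← hT]
    congr 1
    ext x
    simp only [Set.mem_range, Finset.mem_coe, v]
    constructor
    · rintro ⟨i, rfl⟩; exact (T.equivFin.symm i).2
    · intro hx; exact ⟨T.equivFin ⟨x, hx⟩, by simp⟩
  have hSsat : ∀ (x : Fin n → ℤ) (N : ℕ), 0 < N → N • x ∈ AddSubmonoid.closure (Set.range v) →
      x ∈ AddSubmonoid.closure (Set.range v) := by
    intro x N hN hx
    rw [hS] at hx ⊢
    exact IsFaceOf.nsmul_mem_map_proj hsat hπ0 hπ1 hπ2 h.le hN hx
  obtain ⟨M, ℓ, hℓdual, hℓ⟩ := exists_dualInt_generators v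
  -- the embedding: coordinates `ℓ i · π x`
  let e₀ : (Fin n → ℤ) →+ (Fin M → ℤ) :=
    { toFun := fun x i => ℓ i ⬝ᵥ x
      map_zero' := by funext i; exact dotProduct_zero _
      map_add' := fun x y => by funext i; exact dotProduct_add _ _ _ }
  have he₀ : ∀ x i, e₀ x i = ℓ i ⬝ᵥ x := fun x i => rfl
  let e : (Fin n → ℤ) →+ (Fin M → ℤ) := e₀.comp π.toAddMonoidHom
  have he : ∀ x i, e x i = ℓ i ⬝ᵥ π x := fun x i => rfl
  -- reflection at the level of `π(P)`
  have hrefl : ∀ x : Fin n → ℤ, (∀ i, 0 ≤ ℓ i ⬝ᵥ x) → x ∈ P.map π.toAddMonoidHom := by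
    intro x hx
    rw [← hS]
    exact mem_closure_of_forall_generators_nonneg v hSsat hℓ hx
  have hπP : ∀ p ∈ P, π p ∈ AddSubmonoid.closure (Set.range v) := fun p hp =>
    hS ▸ AddSubmonoid.mem_map.2 ⟨p, hp, rfl⟩
  refine ⟨M, e, ⟨fun f hf => ?_, fun p hp i => ?_, fun p hp p' hp' hpp => ?_⟩, fun x hx => ?_⟩
  · -- kills `F`
    funext i
    rw [he, hπ0 f (Submodule.subset_span hf), dotProduct_zero]; rfl
  · -- non-negative on `P`
    rw [he]
    exact dotProduct_nonneg_of_mem_closure v (hℓdual i) (hπP p hp)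
  · -- injective on `P` modulo `F^{gp}`: `±(π p - π p') ∈ π(P)` and `π(P)` is sharp
    have hd : ∀ i, ℓ i ⬝ᵥ (π p - π p') = 0 := by
      intro i
      have h1 := congrFun hpp i
      rw [he, he] at h1
      rw [dotProduct_sub, h1, sub_self]
    have hmem1 : π p - π p' ∈ P.map π.toAddMonoidHom :=
      hrefl _ fun i => (hd i).symm.le
    have hmem2 : π p' - π p ∈ P.map π.toAddMonoidHom :=
      hrefl _ fun i => by rw [← neg_sub, dotProduct_neg, hd, neg_zero]
    obtain ⟨q, hq, hqe⟩ := AddSubmonoid.mem_map.1 hmem1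
    obtain ⟨q', hq', hq'e⟩ := AddSubmonoid.mem_map.1 hmem2
    have e1 : π q = π p - π p' := hqe
    have e2 : π q' = π p' - π p := hq'e
    have hqq : π q + π q' = 0 := by rw [e1, e2]; abel
    have hq0 : π q = 0 := h.sharp_map_proj hπ0 hπ1 hq hq' hqq
    have h1 : π p = π p' := by
      rw [hq0] at e1
      exact (sub_eq_zero.1 e1.symm)
    have h2 : p - p' = (p - π p) - (p' - π p') := by rw [h1]; abel
    rw [h2]
    exact Submodule.sub_mem _ (hπ1 p) (hπ1 p')
  · -- reflecting
    have hx' : ∀ i, 0 ≤ ℓ i ⬝ᵥ π x := fun i => by rw [← he]; exact hx i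
    obtain ⟨q, hq, hqx⟩ := AddSubmonoid.mem_map.1 (hrefl _ hx')
    refine ⟨q, hq, ?_⟩
    funext i
    have e1 : π q = π x := hqx
    rw [he, he, e1]

/-! ### The embedded monoid of a reflecting embedding is pure -/

/-- **Purity of the embedded monoid.** If the sharp embedding `e` reflects `P`
(`e x ≥ 0 ⇒ e x ∈ e(P)`), the embedded monoid `P′ = e(P) ⊆ ℕ^M` (`LogChart.embMonoid`) is PURE:
`a ∈ P′` and `a + b ∈ P′` force `b ∈ P′` (`P′ = gp(P′) ∩ ℕ^M`, Bruns–Gubeladze Thm. 2.29).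
[cite: BrunsGubeladze2009, Thm. 2.29 and Thm. 4.38] -/
theorem embMonoid_pure {M : ℕ} {P F : AddSubmonoid (Fin n → ℤ)} {e : (Fin n → ℤ) →+ (Fin M → ℤ)}
    (he : IsSharpEmbedding P F e)
    (hrefl : ∀ x : Fin n → ℤ, (∀ i, 0 ≤ e x i) → ∃ q ∈ P, e q = e x) :
    ∀ a ∈ embMonoid he, ∀ b : Fin M →₀ ℕ, a + b ∈ embMonoid he → b ∈ embMonoid he := by
  intro a ha b hab
  obtain ⟨p, rfl⟩ := (mem_embMonoid he).1 ha
  obtain ⟨m, hm⟩ := (mem_embMonoid he).1 hab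
  -- `b = e (m - p) ≥ 0` coordinatewise
  have hb : ∀ i, ((b i : ℕ) : ℤ) = e ((m : Fin n → ℤ) - (p : Fin n → ℤ)) i := by
    intro i
    have h1 := congrArg (fun w : Fin M →₀ ℕ => ((w i : ℕ) : ℤ)) hm
    simp only [Finsupp.coe_add, Pi.add_apply, Nat.cast_add, embHom_apply_coe] at h1
    rw [map_sub, Pi.sub_apply, h1, add_sub_cancel_left]
  obtain ⟨q, hq, hqe⟩ := hrefl ((m : Fin n → ℤ) - (p : Fin n → ℤ)) fun i => by
    rw [← hb i]; exact Int.natCast_nonneg _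
  refine (mem_embMonoid he).2 ⟨⟨q, hq⟩, ?_⟩
  ext i
  have h1 : ((embHom he ⟨q, hq⟩ i : ℕ) : ℤ) = ((b i : ℕ) : ℤ) := by
    rw [embHom_apply_coe, hb i]
    exact congrFun hqe i
  exact_mod_cast h1

end LogChart

end Literature.AlgebraicGeometry.Resolution

end
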